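import Mathlib.Geometry.Manifold.ContMDiffMFDeriv
import Mathlib.Geometry.Manifold.MFDeriv.Tangent
import Mathlib.Analysis.Calculus.ContDiff.Operations
import Literature.Topology.FourManifolds.Spin
import Literature.Topology.FourManifolds.ClosedBallSmoothMaps
import HarnessLib

/-!
# The closed ball `𝔻ⁿ⁺¹` is parallelizable

Topic `Literature/Topology/FourManifolds`. We prove that the closed unit ball `𝔻ⁿ⁺¹ ⊆ ℝⁿ⁺¹`, with
the tree's structure of a compact smooth manifold with boundary (`ClosedBall.lean`, model
`𝓡∂ (n + 1)`), is parallelizable in the sense of the tree (`Literature.Topology.FourManifolds.IsParallelizable`, `Spin.lean`: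
the tangent bundle admits `n + 1` continuous, pointwise linearly independent sections):
`Literature.Topology.FourManifolds.IsParallelizable.closedBall`. This discharges the folklore fact used for `[𝕊ⁿ] ∈ bPₙ₊₁`
(`HomotopySpheresBP.lean`: the disc is the neutral framed manifold of Kervaire–Milnor's `bPₙ₊₁`,
Kervaire–Milnor 1963, §4, p. 510; Kosinski, *Differential Manifolds* (1993), Ch. X §6, p. 216).

The proof is the textbook one: *a manifold admitting an equidimensional immersion into the vector
space `E` is parallelizable* (pull back the constant frame of `TE = E × E`; Hirsch, *Differential
Topology* (1976), §4.2, p. 88, "if `TM` is trivial `M` is called parallelizable", and Ex. 4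
p. 97), here `Literature.Topology.FourManifolds.IsParallelizable.of_isInvertible_mfderiv`, applied to the inclusion
`𝔻ⁿ⁺¹ ↪ ℝⁿ⁺¹`, which is `C^∞` (`Literature.Topology.FourManifolds.contMDiff_coe_closedBall`, `ClosedBallSmoothMaps.lean`) with
everywhere invertible differential (`Literature.Topology.FourManifolds.isInvertible_mfderiv_coe_closedBall`: read in the
interior chart it is a translation, in a boundary chart the inverse polar chart
`(polarChart p)⁻¹`, a local diffeomorphism of `ℝⁿ⁺¹`).

Continuity of the pulled-back frame `x ↦ (d j_x)⁻¹ eᵢ` as a section of `TM` is checked in the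
trivialisations of `TM` (`FiberBundle.continuousAt_section`): in the trivialisation at `x₀` it
reads `x ↦ (Ψ x)⁻¹ eᵢ` with `Ψ = inTangentCoordinates I 𝓘(ℝ, E) id j (mfderiv j) x₀` the derivative
of `j` in charts, which is continuous (`ContMDiffAt.mfderiv_const`) with invertible values, and
inversion of continuous linear maps is continuous at invertible maps (`contDiffAt_map_inverse`).

## Mathlib

Mathlib has no parallelizable manifolds (`rg -i paralleli Mathlib`: nothing); used as is:
`TangentBundle`, `trivializationAt`, `inTangentCoordinates`, `ContMDiffAt.mfderiv_const`,
`ContinuousLinearMap.inverse`, `ContinuousLinearMap.IsInvertible`, `contDiffAt_map_inverse`,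
`isInvertible_mfderiv_extChartAt`, `Module.finBasis`.

## References

* M. W. Hirsch, *Differential Topology*, GTM 33, Springer (1976), §4.2 p. 88 (parallelizable),
  §1.4 (manifolds with boundary).
* M. Kervaire, J. Milnor, *Groups of homotopy spheres I*, Ann. of Math. 77 (1963), §4 p. 510.
* A. Kosinski, *Differential Manifolds*, Academic Press (1993), Ch. X §6 p. 216.
-/

open scoped Manifold ContDiff Topology
open Set Module Bundle Metric

noncomputable section

namespace Literature.Topology.FourManifolds

/-! ### Equidimensional immersions into the model vector space -/

section General

variable {E H : Type*} [NormedAddCommGroup E] [NormedSpace ℝ E] [TopologicalSpace H]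
  {I : ModelWithCorners ℝ E H} {M : Type*} [TopologicalSpace M] [ChartedSpace H M]
  [IsManifold I 1 M]

/-- In the trivialisation of `TM` at `x₀`, the tangent vector `v ∈ T_x M = E` (read in the chart at
`x`) has coordinate `d (φ₀)_x v`, `φ₀ = extChartAt I x₀`, for `x` in the chart domain of `x₀`
(Hirsch 1976, §1.4; Mathlib's `TangentBundle.trivializationAt_apply`). [folklore] -/
theorem trivializationAt_tangentSpace_snd {x₀ x : M} (hx : x ∈ (chartAt H x₀).source) (v : E) :
    (trivializationAt E (TangentSpace I) x₀ (⟨x, v⟩ : TangentBundle I M)).2 =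
      mfderiv I 𝓘(ℝ, E) (extChartAt I x₀) x v := by
  rw [TangentBundle.trivializationAt_apply, (hasMFDerivAt_extChartAt (I := I) hx).mfderiv,
    mfderiv_chartAt_eq_tangentCoordChange (I := I) hx, tangentCoordChange_def]
  rfl

/-- For a map `j : M → E` into the model vector space and `x` in the chart domain of `x₀`: if the
differential `d j_x` is invertible, then so is the derivative of `j` read in the charts at `x₀`,
`Ψ x = inTangentCoordinates I 𝓘(ℝ, E) id j (mfderiv j) x₀ x = d j_x ∘ (d (φ₀)_x)⁻¹`,
`φ₀ = extChartAt I x₀` (Hirsch 1976, §1.4: derivatives in charts; extended charts have invertible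
differentials, Mathlib's `isInvertible_mfderiv_extChartAt`). [folklore] -/
theorem isInvertible_inTangentCoordinates_model {j : M → E} {x₀ x : M}
    (hx : x ∈ (chartAt H x₀).source) (hj : (mfderiv I 𝓘(ℝ, E) j x).IsInvertible) :
    (inTangentCoordinates I 𝓘(ℝ, E) id j (mfderiv I 𝓘(ℝ, E) j) x₀ x).IsInvertible := by
  have hx' : x ∈ (extChartAt I x₀).source := by rwa [extChartAt_source]
  have hS : (mfderivWithin 𝓘(ℝ, E) I (extChartAt I x₀).symm (range I)
      (extChartAt I x₀ x)).IsInvertible :=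
    ContinuousLinearMap.IsInvertible.of_inverse
      (mfderivWithin_extChartAt_symm_comp_mfderiv_extChartAt' (I := I) hx')
      (mfderiv_extChartAt_comp_mfderivWithin_extChartAt_symm' (I := I) hx')
  have hD : (mfderiv 𝓘(ℝ, E) 𝓘(ℝ, E) (extChartAt 𝓘(ℝ, E) (j x₀)) (j x)).IsInvertible :=
    isInvertible_mfderiv_extChartAt (by simp)
  rw [inTangentCoordinates_eq_mfderiv_comp (I := I) (I' := 𝓘(ℝ, E)) (f := id) (g := j) hx
    (by simp)]
  exact hD.comp (hj.comp hS)

/-- **The pulled-back frame in a trivialisation.** For `j : M → E` with invertible differential at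
`x`, the tangent vector `(d j_x)⁻¹ w ∈ T_x M`, read in the trivialisation of `TM` at `x₀` (`x` in
the chart domain of `x₀`), is `(Ψ x)⁻¹ w` with `Ψ x = d j_x ∘ (d (φ₀)_x)⁻¹` the derivative of `j` in
charts (`inTangentCoordinates`): indeed `d (φ₀)_x ∘ (d j_x)⁻¹ = (d j_x ∘ (d (φ₀)_x)⁻¹)⁻¹`
(Hirsch 1976, §1.4 and §4.2). [folklore] -/
theorem trivializationAt_snd_inverse_mfderiv {j : M → E} {x₀ x : M}
    (hx : x ∈ (chartAt H x₀).source) (hj : (mfderiv I 𝓘(ℝ, E) j x).IsInvertible) (w : E) :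
    (trivializationAt E (TangentSpace I) x₀
        (⟨x, (mfderiv I 𝓘(ℝ, E) j x).inverse w⟩ : TangentBundle I M)).2 =
      (inTangentCoordinates I 𝓘(ℝ, E) id j (mfderiv I 𝓘(ℝ, E) j) x₀ x).inverse w := by
  have hx' : x ∈ (extChartAt I x₀).source := by rwa [extChartAt_source]
  have hΨ := inTangentCoordinates_eq_mfderiv_comp (I := I) (I' := 𝓘(ℝ, E)) (f := id) (g := j)
    (ϕ := mfderiv I 𝓘(ℝ, E) j) (x₀ := x₀) hx (by simp)
  have hΨinv := isInvertible_inTangentCoordinates_model hx hj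
  rw [trivializationAt_tangentSpace_snd hx]
  set A : E →L[ℝ] E := mfderiv I 𝓘(ℝ, E) j x with hA
  set T : E →L[ℝ] E := mfderiv I 𝓘(ℝ, E) (extChartAt I x₀) x with hT
  set S : E →L[ℝ] E := mfderivWithin 𝓘(ℝ, E) I (extChartAt I x₀).symm (range I)
    (extChartAt I x₀ x) with hS
  set D : E →L[ℝ] E := mfderiv 𝓘(ℝ, E) 𝓘(ℝ, E) (extChartAt 𝓘(ℝ, E) (j x₀)) (j x) with hD
  have hST : ∀ u : E, S (T u) = u := fun u =>
    DFunLike.congr_fun (mfderivWithin_extChartAt_symm_comp_mfderiv_extChartAt' (I := I) hx') u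
  have hAinv : ∀ u : E, A (A.inverse u) = u := hj.self_apply_inverse
  have hDu : ∀ u : E, D u = u := by
    have : D = ContinuousLinearMap.id ℝ E := by
      rw [hD, extChartAt_self_eq, modelWithCornersSelf_coe]
      exact mfderiv_id
    intro u
    rw [this]
    rfl
  symm
  rw [hΨinv.inverse_apply_eq, hΨ]
  show w = D (A (S (T (A.inverse w))))
  rw [hST, hAinv, hDu]

/-- **An equidimensional immersion into the model vector space parallelizes.** If `j : M → E` is
`C¹` from a manifold `M` modelled on `I : ModelWithCorners ℝ E H` (possibly with boundary or
corners) to the (finite-dimensional) vector space `E`, and its differential `d j_x : T_x M → E` is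
invertible at every point, then `M` is parallelizable: the sections `x ↦ (d j_x)⁻¹ eᵢ`, for a
basis `(eᵢ)` of `E`, form a continuous global frame of `TM` (the pull-back of the constant frame
of `TE = E × E`; Hirsch, *Differential Topology* (1976), §4.2, p. 88). Continuity is checked in the
trivialisations of `TM` (`trivializationAt_snd_inverse_mfderiv`): there the frame reads
`x ↦ (Ψ x)⁻¹ eᵢ`, with `Ψ` continuous (`ContMDiffAt.mfderiv_const`) and inversion continuous at
invertible maps (`contDiffAt_map_inverse`). [folklore] -/
theorem IsParallelizable.of_isInvertible_mfderiv [FiniteDimensional ℝ E] {j : M → E}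
    (hj : ContMDiff I 𝓘(ℝ, E) 1 j) (hinv : ∀ x, (mfderiv I 𝓘(ℝ, E) j x).IsInvertible) :
    IsParallelizable I M := by
  classical
  set b := Module.finBasis ℝ E with hb
  refine ⟨fun i x => (mfderiv I 𝓘(ℝ, E) j x).inverse (b i), fun i => ?_, fun x => ?_⟩
  · -- continuity of the `i`-th section, checked in the trivialisation at each `x₀`
    rw [continuous_iff_continuousAt]
    intro x₀
    rw [show (fun p : M => (TotalSpace.mk' E (id p) ((mfderiv I 𝓘(ℝ, E) j p).inverse (b i)) :
        TangentBundle I M)) = fun p : M => TotalSpace.mk' E p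
          ((fun q : M => ((mfderiv I 𝓘(ℝ, E) j q).inverse (b i) : TangentSpace I q)) p) from rfl,
      FiberBundle.continuousAt_section]
    set Ψ := inTangentCoordinates I 𝓘(ℝ, E) id j (mfderiv I 𝓘(ℝ, E) j) x₀ with hΨ
    -- `Ψ` is continuous at `x₀` with invertible value there
    have hΨc : ContinuousAt Ψ x₀ :=
      ((hj x₀).mfderiv_const (m := 0) (by rw [zero_add])).continuousAt
    obtain ⟨e, he⟩ := isInvertible_inTangentCoordinates_model (mem_chart_source H x₀) (hinv x₀)
    have hinvc : ContinuousAt (fun x => (Ψ x).inverse (b i)) x₀ := by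
      have h1 : ContinuousAt ContinuousLinearMap.inverse (Ψ x₀) := by
        rw [hΨ, ← he]
        exact (contDiffAt_map_inverse (n := 0) e).continuousAt
      exact (h1.comp hΨc).clm_apply continuousAt_const
    refine hinvc.congr ?_
    filter_upwards [(chartAt H x₀).open_source.mem_nhds (mem_chart_source H x₀)] with x hx
    exact (trivializationAt_snd_inverse_mfderiv hx (hinv x) (b i)).symm
  · -- pointwise linear independence: `d j_x` maps the family to the basis `b`
    beta_reduce
    set A : E →L[ℝ] E := mfderiv I 𝓘(ℝ, E) j x with hA
    refine LinearIndependent.of_comp A.toLinearMap ?_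
    convert b.linearIndependent using 1
    funext i
    exact (hinv x).self_apply_inverse (b i)

end General

/-! ### The inclusion `𝔻ⁿ⁺¹ ↪ ℝⁿ⁺¹` has invertible differential -/

variable {n : ℕ}

/-- The derivative of the inverse of a partial homeomorphism of a normed space which is `C¹` on
its (open) source, with `C¹` inverse, is invertible at every point of the target: both composites
with the derivative of the map are the identity by the chain rule (Hirsch 1976, §1.1). [folklore] -/
theorem isInvertible_fderiv_symm_of_contDiffOn {F : Type*} [NormedAddCommGroup F]
    [NormedSpace ℝ F] (e : OpenPartialHomeomorph F F) (he : ContDiffOn ℝ 1 e e.source)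
    (he' : ContDiff ℝ 1 e.symm) {z : F} (hz : z ∈ e.target) :
    (fderiv ℝ e.symm z).IsInvertible := by
  have hsz : e.symm z ∈ e.source := e.map_target hz
  have hd : HasFDerivAt e (fderiv ℝ e (e.symm z)) (e.symm z) :=
    ((he.differentiableOn one_ne_zero).differentiableAt (e.open_source.mem_nhds hsz)).hasFDerivAt
  have hd' : HasFDerivAt e.symm (fderiv ℝ e.symm z) z :=
    (he'.differentiable one_ne_zero z).hasFDerivAt
  refine ContinuousLinearMap.IsInvertible.of_inverse (g := fderiv ℝ e (e.symm z)) ?_ ?_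
  · -- `d(e.symm)_z ∘ d e_{e.symm z} = id`: differentiate `e.symm ∘ e = id` at `e.symm z`
    have hz' : e (e.symm z) = z := e.right_inv hz
    have hc : HasFDerivAt (e.symm ∘ e) ((fderiv ℝ e.symm z) ∘L (fderiv ℝ e (e.symm z)))
        (e.symm z) := by
      refine HasFDerivAt.comp _ ?_ hd
      rwa [hz']
    have hid : HasFDerivAt (e.symm ∘ e) (ContinuousLinearMap.id ℝ F) (e.symm z) :=
      (hasFDerivAt_id _).congr_of_eventuallyEq
        ((e.eventually_left_inverse hsz).mono fun y hy => by simp [hy])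
    exact hc.unique hid
  · -- `d e_{e.symm z} ∘ d(e.symm)_z = id`: differentiate `e ∘ e.symm = id` at `z`
    have hc : HasFDerivAt (e ∘ e.symm) ((fderiv ℝ e (e.symm z)) ∘L (fderiv ℝ e.symm z)) z :=
      hd.comp z hd'
    have hid : HasFDerivAt (e ∘ e.symm) (ContinuousLinearMap.id ℝ F) z :=
      (hasFDerivAt_id _).congr_of_eventuallyEq
        ((e.eventually_right_inverse hz).mono fun y hy => by simp [hy])
    exact hc.unique hid

/-- **The inclusion `𝔻ⁿ⁺¹ ↪ ℝⁿ⁺¹` is an immersion** (indeed an equidimensional one): its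
differential, for the manifold-with-boundary structure of `𝔻ⁿ⁺¹` (model `𝓡∂ (n + 1)`), is
invertible at every point. Near an interior point the inclusion is the translation
`z ↦ z - 2e₀` after the extended interior chart, near a boundary point it is the inverse polar
chart `(polarChart p)⁻¹` after the extended boundary chart (`ClosedBallSmoothMaps.lean`), and
extended charts have invertible differentials (`isInvertible_mfderiv_extChartAt`).
Lee, *Introduction to Smooth Manifolds* (2013), Prop. 5.46 ff. (regular domains are embedded
submanifolds with boundary of codimension `0`). [folklore] -/
theorem isInvertible_mfderiv_coe_closedBall
    (x : (closedBall (0 : EuclideanSpace ℝ (Fin (n + 1))) 1)) :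
    (mfderiv (𝓡∂ (n + 1)) 𝓘(ℝ, EuclideanSpace ℝ (Fin (n + 1)))
      (Subtype.val : (closedBall (0 : EuclideanSpace ℝ (Fin (n + 1))) 1) →
        EuclideanSpace ℝ (Fin (n + 1))) x).IsInvertible := by
  have hxs : x ∈ (chartAt (EuclideanHalfSpace (n + 1)) x).source := mem_chart_source _ x
  have hext : (mfderiv (𝓡∂ (n + 1)) 𝓘(ℝ, EuclideanSpace ℝ (Fin (n + 1)))
      (extChartAt (𝓡∂ (n + 1)) x) x).IsInvertible :=
    isInvertible_mfderiv_extChartAt (by rw [extChartAt_source]; exact hxs)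
  have hextd : MDifferentiableAt (𝓡∂ (n + 1)) 𝓘(ℝ, EuclideanSpace ℝ (Fin (n + 1)))
      (extChartAt (𝓡∂ (n + 1)) x) x :=
    mdifferentiableAt_extChartAt hxs
  by_cases hx : ‖(x : EuclideanSpace ℝ (Fin (n + 1)))‖ < 1
  · -- interior point: `val = (z ↦ z - 2e₀) ∘ extChartAt x` near `x`
    set g : EuclideanSpace ℝ (Fin (n + 1)) → EuclideanSpace ℝ (Fin (n + 1)) :=
      fun z => z - (2 : ℝ) • closedBallBaseVector n with hg
    have hgd : MDifferentiableAt 𝓘(ℝ, EuclideanSpace ℝ (Fin (n + 1)))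
        𝓘(ℝ, EuclideanSpace ℝ (Fin (n + 1))) g (extChartAt (𝓡∂ (n + 1)) x x) :=
      ((differentiable_id.sub_const _) _).mdifferentiableAt
    have heq : (Subtype.val : (closedBall (0 : EuclideanSpace ℝ (Fin (n + 1))) 1) →
        EuclideanSpace ℝ (Fin (n + 1))) =ᶠ[𝓝 x] g ∘ extChartAt (𝓡∂ (n + 1)) x := by
      refine Filter.Eventually.of_forall fun y => ?_
      simp only [hg, Function.comp_apply, extChartAt, OpenPartialHomeomorph.extend_coe,
        modelWithCornersEuclideanHalfSpace_apply, closedBall_chartAt_of_norm_lt_one hx,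
        coe_closedBallInteriorChart_apply, add_sub_cancel_right]
    have hginv : (mfderiv 𝓘(ℝ, EuclideanSpace ℝ (Fin (n + 1)))
        𝓘(ℝ, EuclideanSpace ℝ (Fin (n + 1))) g (extChartAt (𝓡∂ (n + 1)) x x)).IsInvertible := by
      rw [mfderiv_eq_fderiv, hg, fderiv_sub_const, fderiv_fun_id]
      exact ⟨ContinuousLinearEquiv.refl ℝ _, rfl⟩
    rw [heq.mfderiv_eq, mfderiv_comp x hgd hextd]
    exact hginv.comp hext
  · -- boundary point: `val = (polarChart p).symm ∘ extChartAt x` near `x`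
    have hx1 : ‖(x : EuclideanSpace ℝ (Fin (n + 1)))‖ = 1 :=
      (mem_closedBall_zero_iff.1 x.2).antisymm (not_lt.1 hx)
    set p : (sphere (0 : EuclideanSpace ℝ (Fin (n + 1))) 1) :=
      ⟨x, mem_sphere_zero_iff_norm.2 hx1⟩ with hp
    have hchart : chartAt (EuclideanHalfSpace (n + 1)) x = closedBallBoundaryChart p :=
      closedBall_chartAt_of_norm_eq_one hx1
    set g : EuclideanSpace ℝ (Fin (n + 1)) → EuclideanSpace ℝ (Fin (n + 1)) :=
      ((polarChart p).symm : EuclideanSpace ℝ (Fin (n + 1)) → EuclideanSpace ℝ (Fin (n + 1)))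
      with hg
    have hg1 : ContDiff ℝ 1 g := (contDiff_polarChart_symm p).of_le (by exact_mod_cast le_top)
    have hgd : MDifferentiableAt 𝓘(ℝ, EuclideanSpace ℝ (Fin (n + 1)))
        𝓘(ℝ, EuclideanSpace ℝ (Fin (n + 1))) g (extChartAt (𝓡∂ (n + 1)) x x) :=
      (hg1.differentiable one_ne_zero _).mdifferentiableAt
    have heq : (Subtype.val : (closedBall (0 : EuclideanSpace ℝ (Fin (n + 1))) 1) →
        EuclideanSpace ℝ (Fin (n + 1))) =ᶠ[𝓝 x] g ∘ extChartAt (𝓡∂ (n + 1)) x := by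
      filter_upwards [(chartAt (EuclideanHalfSpace (n + 1)) x).open_source.mem_nhds hxs]
        with y hy
      rw [hchart] at hy
      have hy' : (y : EuclideanSpace ℝ (Fin (n + 1))) ∈ (polarChart p).source :=
        (mem_closedBallBoundaryChart_source_iff p y).1 hy
      simp only [hg, Function.comp_apply, extChartAt, OpenPartialHomeomorph.extend_coe,
        modelWithCornersEuclideanHalfSpace_apply, hchart,
        coe_closedBallBoundaryChart_eq_polarChart, (polarChart p).left_inv hy']
    -- `extChartAt x x = polarChart p x` lies in the target `{z | z 0 < 1}` of the polar chart
    have htgt : extChartAt (𝓡∂ (n + 1)) x x ∈ (polarChart p).target := by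
      rw [polarChart_target]
      show (extChartAt (𝓡∂ (n + 1)) x x) 0 < 1
      simp only [extChartAt, OpenPartialHomeomorph.extend_coe, Function.comp_apply,
        modelWithCornersEuclideanHalfSpace_apply, hchart, coe_closedBallBoundaryChart_apply_zero,
        sub_lt_self_iff, hx1]
      norm_num
    have hginv : (mfderiv 𝓘(ℝ, EuclideanSpace ℝ (Fin (n + 1)))
        𝓘(ℝ, EuclideanSpace ℝ (Fin (n + 1))) g (extChartAt (𝓡∂ (n + 1)) x x)).IsInvertible := by
      rw [mfderiv_eq_fderiv, hg]
      exact isInvertible_fderiv_symm_of_contDiffOn (polarChart p)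
        ((contDiffOn_polarChart p).of_le (by exact_mod_cast le_top)) hg1 htgt
    rw [heq.mfderiv_eq, mfderiv_comp x hgd hextd]
    exact hginv.comp hext

/-- **The closed ball `𝔻ⁿ⁺¹` is parallelizable**: its tangent bundle (for the manifold-with-boundary
structure `Literature.Topology.FourManifolds.instChartedSpaceClosedBall`, model `𝓡∂ (n + 1)`) admits a continuous global frame,
namely the pull-back of the constant frame of `ℝⁿ⁺¹` along the inclusion, `TDⁿ⁺¹ = Dⁿ⁺¹ × ℝⁿ⁺¹`
(Hirsch, *Differential Topology* (1976), §4.2, p. 88; the framed disc is the neutral element of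
Kosinski's group `Pᵐ` of framed manifolds, Kosinski 1993, Ch. X §6, p. 216, and `Sⁿ = bDⁿ⁺¹`
represents `0 ∈ bPₙ₊₁`, Kervaire–Milnor 1963, §4, proof of Lemma 4.2). [folklore] -/
theorem IsParallelizable.closedBall (n : ℕ) :
    IsParallelizable (𝓡∂ (n + 1)) (closedBall (0 : EuclideanSpace ℝ (Fin (n + 1))) 1) :=
  IsParallelizable.of_isInvertible_mfderiv
    (contMDiff_coe_closedBall.of_le (by exact_mod_cast le_top))
    isInvertible_mfderiv_coe_closedBall

end Literature.Topology.FourManifolds
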